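import Mathlib.LinearAlgebra.Matrix.Rank
import Mathlib.Algebra.MvPolynomial.Degrees
import Mathlib.Data.Real.Basic
import Literature.Computability.AlgebraicComplexity.OrbitClosure
import HarnessLib

/-!
# Kumar–Volk: a polynomial degree bound on equations for non-rigid matrices (typed statements of
# §1.1–§1.2, §2–§3: Thm 1.1, Lemma 2.1, Lemmas 3.1–3.2)

Source: M. Kumar, B. L. Volk, *A polynomial degree bound on equations for non-rigid matrices and
small linear circuits*, ACM TOCT 14(2) (2022) art. 6 = ITCS 2021 = arXiv:2003.12938, bib key
`KumarVolk2022` (the tree's `KumarVolk2022b` / `KV22PowerSum*` is a DIFFERENT paper, whence the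
prefixes `kumarVolk2020_` (arXiv year) / `KV20`). JOURNAL numbering (Thm 1.1, 1.2, Cor 1.3, Thm 1.4,
Lemma 2.1, 3.1, 3.2, 4.1, 5.4, Thm 5.5, Lemma 5.6); the arXiv text numbers them Thm 1, 2, Cor 3,
Lemma 4, 5, 8, 9, Thm 10, Lemma 11, Thm 12 and inlines Lemma 2.1. Locators: `[s2 pNNNN]` = chunks of
`lit read paper:doi-10-1145-3543685`, `[tex pNNNN]` = chunks of `lit read paper:arxiv-2003.12938`.
Honest framing (val-lit): published statements TYPED as cite-tagged `def … : Prop` named facts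
(D-0014) over the tree's vocabulary plus small proved API lemmas; every fact is an unconditional
theorem of the source, dischargeable by name; nothing here bears on `VP ≠ VNP`.

Source item → decl (this file = §1.1–§1.2, §2–§3): §1.1 equation / `Δ(V)` → `IsEquationFor`,
`minEquationDegree` (+ API, incl. `isEquationFor_zariskiClosure_iff` over the tree's
`zariskiClosure`); §1.2 → `IsSparse`, `IsRigid`, `nonRigidSet` (`A_{r,s}`), `nonRigidVariety`
(`V_{r,s}`); Thm 1.1 → `kumarVolk2020_thm_1_1` (fact) + `kumarVolk2020_thm_1_1.delta_le`
(`Δ(V_{r,s}) ≤ n³`, derived); Lemma 2.1 → `kumarVolk2020_lem_2_1` (fact); Lemma 3.1 [SV15] →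
`kumarVolk2020_lem_3_1` (fact); Lemma 3.2 → `kumarVolk2020_lem_3_2` (fact); polynomial maps →
`polyMapImage`. Second section file `KV20LinearCircuitEquations.lean`: §1.3 linear circuits,
Lemma 4.1, Thm 1.2, §5 (Lemma 5.4, Thm 5.5, Lemma 5.6, Thm 1.4 over the tree's `tensorRankD`).
NOT typed: Cor 1.3 / Cor 6.4 / §6 (PIT win–win; needs Boolean uniformity vocabulary — a third
section file if requested), Remarks 3.3–3.4 (prose), the [KLPS14]/[GHIL16] statements quoted in §1.2
(other sources).

Conventions made explicit. (1) The source's `ℕ` is `{1,2,…}`: Thm 1.4 / 5.5 carry `1 ≤ n`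
(`1 ≤ d`); for `n = 0` the sentence is false in Lean (a nonzero equation of degree `≤ 0` is a
nonzero constant). Bounds `n^{d-1}/(100d)`, `n²/300`, `n²/200` are floor divisions ("at most").
(2) "`F` of size at least `N`" is `Nonempty (Fin N ↪ F)`. (3) Thm 1.1: `ε` real, `0 < ε < 1/25`;
"not `(εn, εn²)`-rigid" is rendered by natural parameters `r ≤ εn`, `s ≤ εn²` (non-rigidity is
monotone, `nonRigidSet_mono`, so this is the printed statement with the rounding explicit); "for
every large enough `n`" = `∃ n₀, ∀ n ≥ n₀`, `n₀` depending on `ε` only, as in the proof. (4) Matrices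
are points `Fin n × Fin n → F` of affine space (`matrixOfPt`), tensors `[n]^d → F` are points
`(Fin d → Fin n) → F`, so `MvPolynomial.eval` and `zariskiClosure` apply verbatim. (5) The linear
circuits of §1.3 / Thm 1.2 are modelled in the second section file.

References: [KumarVolk2022] doi:10.1145/3543685, arXiv:2003.12938; [SV15] Shpilka–Volkovich, Comput.
Complexity 24 (2015) (Lemma 3.1's map); [KLPS14] Kumar–Lokam–Patankar–Sarma, Comput. Complexity 23
(2014) and [GHIL16] Gesmundo–Hauenstein–Ikenmeyer–Landsberg, FoCM 16 (2016) (the prior,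
exponential, degree bounds; [GHIL16] asked for the polynomial bound that Thm 1.1 proves).
-/

noncomputable section

open MvPolynomial

namespace Literature.Computability.AlgebraicComplexity

/-! ### §1.1 Equations for varieties and the measure `Δ(V)` -/

section Equations

variable {F : Type*} [CommSemiring F] {ι : Type*}

/-- **An equation for a set `A ⊆ Fⁿ`** (KV §1.1, [s2 p0002]: "Let `V ⊆ Fⁿ` be an affine variety
and let `I(V)` denote its ideal, i.e., the set of polynomials vanishing on `V`. A non-zero
polynomial `P ∈ I(V)` is called an equation for `V`."): `P ≠ 0` and `P` vanishes at every point of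
`A`. Stated for an arbitrary subset `A` of affine space `ι → F` (for a variety this is the printed
notion; an equation for `A` is the same as an equation for its Zariski closure,
`isEquationFor_zariskiClosure_iff`). [cite: KumarVolk2022, §1.1] -/
def IsEquationFor (A : Set (ι → F)) (P : MvPolynomial ι F) : Prop :=
  P ≠ 0 ∧ ∀ x ∈ A, eval x P = 0

/-- **`Δ(V) := min_{0 ≠ P ∈ I(V)} deg(P)`** (KV §1.1, [s2 p0002]: "The quantity `Δ(V)` can be
thought of as a measure of complexity for the geometry of the variety `V`"): the least total
degree of an equation for `A`; junk value `0` (`sInf ∅`) when `A` has no equation (e.g. `A` the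
whole space over an infinite field). [cite: KumarVolk2022, §1.1] -/
def minEquationDegree (A : Set (ι → F)) : ℕ :=
  sInf {d | ∃ P : MvPolynomial ι F, IsEquationFor A P ∧ P.totalDegree = d}

/-- Unfolding lemma. [cite: KumarVolk2022, §1.1] -/
theorem isEquationFor_iff (A : Set (ι → F)) (P : MvPolynomial ι F) :
    IsEquationFor A P ↔ P ≠ 0 ∧ ∀ x ∈ A, eval x P = 0 :=
  Iff.rfl

/-- An equation for `B` is an equation for every subset `A ⊆ B`. [cite: KumarVolk2022, §1.1] -/
theorem IsEquationFor.mono {A B : Set (ι → F)} {P : MvPolynomial ι F} (h : IsEquationFor B P)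
    (hAB : A ⊆ B) : IsEquationFor A P :=
  ⟨h.1, fun x hx => h.2 x (hAB hx)⟩

/-- `Δ(A) ≤ deg P` for every equation `P` of `A`. [cite: KumarVolk2022, §1.1] -/
theorem minEquationDegree_le {A : Set (ι → F)} {P : MvPolynomial ι F} (h : IsEquationFor A P) :
    minEquationDegree A ≤ P.totalDegree :=
  Nat.sInf_le ⟨P, h, rfl⟩

end Equations

section EquationsField

variable {F : Type*} [Field F] {ι : Type*}

/-- An equation for `A` is the same thing as an equation for the Zariski closure `\overline{A}`
(KV §2.1, [s2 p0008]: "a polynomial that vanishes everywhere on `A` also vanishes on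
`\overline{A}`"), the closure being the tree's `zariskiClosure`. [cite: KumarVolk2022, §2.1] -/
theorem isEquationFor_zariskiClosure_iff (A : Set (ι → F)) (P : MvPolynomial ι F) :
    IsEquationFor (zariskiClosure A) P ↔ IsEquationFor A P := by
  refine ⟨fun h => h.mono (subset_zariskiClosure A), fun h => ⟨h.1, fun x hx => ?_⟩⟩
  have key : ∀ z : ι → F, aeval z P = eval z P := fun z => by
    rw [MvPolynomial.aeval_def, Algebra.algebraMap_self]; rfl
  have hx' := (mem_zariskiClosure_iff.mp hx) P (fun y hy => by rw [key]; exact h.2 y hy)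
  rwa [key] at hx'

/-- Consequently `Δ(\overline{A}) = Δ(A)`. [cite: KumarVolk2022, §2.1] -/
theorem minEquationDegree_zariskiClosure (A : Set (ι → F)) :
    minEquationDegree (zariskiClosure A) = minEquationDegree A := by
  simp only [minEquationDegree, isEquationFor_zariskiClosure_iff]

end EquationsField

/-! ### §1.2 Rigid matrices: `(r,s)`-rigidity, `A_{r,s}` and `V_{r,s}` -/

section Sparse

variable {F : Type*} [Zero F] {μ ν : Type*}

/-- **`s`-sparse matrices**: "`S` contains at most `s` non-zero entries" (KV §1.2, [s2 p0004]),
rendered as: the support of `S` is contained in a set of at most `s` positions.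
[cite: KumarVolk2022, §1.2] -/
def IsSparse (s : ℕ) (S : Matrix μ ν F) : Prop :=
  ∃ T : Finset (μ × ν), T.card ≤ s ∧ ∀ i j, (i, j) ∉ T → S i j = 0

/-- The zero matrix is `s`-sparse for every `s`. [cite: KumarVolk2022, §1.2] -/
theorem isSparse_zero (s : ℕ) : IsSparse s (0 : Matrix μ ν F) :=
  ⟨∅, by simp, fun _ _ _ => rfl⟩

/-- Sparsity is monotone in the budget. [cite: KumarVolk2022, §1.2] -/
theorem IsSparse.mono {s s' : ℕ} {S : Matrix μ ν F} (h : IsSparse s S) (hs : s ≤ s') :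
    IsSparse s' S := by
  obtain ⟨T, hT, hS⟩ := h
  exact ⟨T, hT.trans hs, hS⟩

end Sparse

section MatrixPoints

variable (F : Type*)

/-- The matrix `M ∈ F^{n×n}` sitting at the point `x ∈ F^{[n]×[n]}` of affine space (coordinates
`x_{i,j} = M i j`; KV's `Q ∈ F[x_{1,1}, …, x_{n,n}]`, [s2 p0004]). [cite: KumarVolk2022, §1.2] -/
def matrixOfPt {n : ℕ} (x : Fin n × Fin n → F) : Matrix (Fin n) (Fin n) F :=
  Matrix.of fun i j => x (i, j)

variable {F}

/-- Unfolding lemma for `matrixOfPt`. [cite: KumarVolk2022, §1.2] -/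
@[simp] theorem matrixOfPt_apply {n : ℕ} (x : Fin n × Fin n → F) (i j : Fin n) :
    matrixOfPt F x i j = x (i, j) := rfl

end MatrixPoints

section Rigidity

variable {F : Type*} [Field F] {μ ν : Type*} [Fintype ν]

/-- **`(r,s)`-rigid matrices** (KV §1.2, [s2 p0004]: "A matrix `M` is `(r,s)`-rigid if `M` cannot
be written as a sum `R + S` where `rank(R) ≤ r` and `S` contains at most `s` non-zero entries."
[Valiant77]). [cite: KumarVolk2022, §1.2] -/
def IsRigid (r s : ℕ) (M : Matrix μ ν F) : Prop :=
  ¬ ∃ R S : Matrix μ ν F, R.rank ≤ r ∧ IsSparse s S ∧ M = R + S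

/-- Non-rigidity is monotone in `(r, s)`: a matrix that is not `(r,s)`-rigid is not
`(r',s')`-rigid for `r ≤ r'`, `s ≤ s'`. [cite: KumarVolk2022, §1.2] -/
theorem not_isRigid_mono {r r' s s' : ℕ} {M : Matrix μ ν F} (h : ¬ IsRigid r s M) (hr : r ≤ r')
    (hs : s ≤ s') : ¬ IsRigid r' s' M := by
  intro h'
  apply h
  rintro ⟨R, S, hR, hS, hM⟩
  exact h' ⟨R, S, hR.trans hr, hS.mono hs, hM⟩

variable (F)

/-- **`A_{r,s} ⊆ F^{n×n}`**, "the set of matrices that are not `(r,s)`-rigid" (KV §1.2,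
[s2 p0004]), as a subset of affine space `Fin n × Fin n → F`. [cite: KumarVolk2022, §1.2] -/
def nonRigidSet (n r s : ℕ) : Set (Fin n × Fin n → F) :=
  {x | ¬ IsRigid r s (matrixOfPt F x)}

/-- **`V_{r,s} = \overline{A_{r,s}}`**, "the Zariski closure of `A_{r,s}`" (KV §1.2, [s2 p0004];
the paper takes `F` algebraically closed here), via the tree's `zariskiClosure`. Its equations are
exactly the equations of `A_{r,s}` (`isEquationFor_zariskiClosure_iff`). [cite: KumarVolk2022, §1.2] -/
def nonRigidVariety (n r s : ℕ) : Set (Fin n × Fin n → F) :=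
  zariskiClosure (nonRigidSet F n r s)

variable {F}

/-- Membership in `A_{r,s}`. [cite: KumarVolk2022, §1.2] -/
theorem mem_nonRigidSet_iff {n r s : ℕ} (x : Fin n × Fin n → F) :
    x ∈ nonRigidSet F n r s ↔
      ∃ R S : Matrix (Fin n) (Fin n) F, R.rank ≤ r ∧ IsSparse s S ∧ matrixOfPt F x = R + S := by
  simp [nonRigidSet, IsRigid]

/-- `A_{r,s} ⊆ A_{r',s'}` for `r ≤ r'`, `s ≤ s'`. [cite: KumarVolk2022, §1.2] -/
theorem nonRigidSet_mono {n r r' s s' : ℕ} (hr : r ≤ r') (hs : s ≤ s') :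
    nonRigidSet F n r s ⊆ nonRigidSet F n r' s' :=
  fun _ hx => not_isRigid_mono hx hr hs

/-- The zero matrix lies in every `A_{r,s}` (so `A_{r,s}` is nonempty and its equations are
non-trivial constraints). [cite: KumarVolk2022, §1.2] -/
theorem zero_mem_nonRigidSet (n r s : ℕ) : (0 : Fin n × Fin n → F) ∈ nonRigidSet F n r s := by
  rw [mem_nonRigidSet_iff]
  refine ⟨0, 0, by simp, isSparse_zero s, ?_⟩
  ext i j
  simp

/-- `A_{r,s} ⊆ V_{r,s}`. [cite: KumarVolk2022, §1.2] -/
theorem nonRigidSet_subset_nonRigidVariety (n r s : ℕ) :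
    nonRigidSet F n r s ⊆ nonRigidVariety F n r s :=
  subset_zariskiClosure _

end Rigidity

/-! ### Theorem 1.1: a degree-`n³` equation for non-rigid matrices -/

/-- **Kumar–Volk, Thm 1.1** ([s2 p0004:L5]; arXiv Thm 1, [tex p0002]): "Let `ε < 1/25`, and let `F`
be a field of size at least `n²`. For every large enough `n`, there exists a non-zero polynomial
`Q ∈ F[x_{1,1}, …, x_{n,n}]`, of degree at most `n³`, which is a non-trivial equation for matrices
that are not `(εn, εn²)`-rigid. That is, for every such matrix `M`, `Q(M) = 0`." (This proves
the polynomial growth of `Δ(V_{εn, n^{1+δ}})` predicted in [GHIL16].) Typed with the conventions of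
the module docstring: `0 < ε < 1/25` real; threshold `n₀` depending on `ε`; field size via an
embedding `Fin (n²) ↪ F`; natural parameters `r ≤ εn`, `s ≤ εn²` (monotonicity
`nonRigidSet_mono`). [cite: KumarVolk2022, Thm. 1.1] -/
def kumarVolk2020_thm_1_1 : Prop :=
  ∀ ε : ℝ, 0 < ε → ε < 1 / 25 → ∃ n₀ : ℕ, ∀ n : ℕ, n₀ ≤ n →
    ∀ (F : Type) [Field F], Nonempty (Fin (n ^ 2) ↪ F) →
      ∀ r s : ℕ, (r : ℝ) ≤ ε * n → (s : ℝ) ≤ ε * (n : ℝ) ^ 2 →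
        ∃ Q : MvPolynomial (Fin n × Fin n) F,
          IsEquationFor (nonRigidSet F n r s) Q ∧ Q.totalDegree ≤ n ^ 3

/-- Thm 1.1 in the `Δ`-form of §1.1: under its hypotheses `Δ(V_{r,s}) ≤ n³` (consequence of the
fact, via `minEquationDegree_le` and `minEquationDegree_zariskiClosure`). [cite: KumarVolk2022, Thm. 1.1] -/
theorem kumarVolk2020_thm_1_1.delta_le (h : kumarVolk2020_thm_1_1) {ε : ℝ}
    (hε : 0 < ε) (hε' : ε < 1 / 25) :
    ∃ n₀ : ℕ, ∀ n : ℕ, n₀ ≤ n → ∀ (F : Type) [Field F], Nonempty (Fin (n ^ 2) ↪ F) →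
      ∀ r s : ℕ, (r : ℝ) ≤ ε * n → (s : ℝ) ≤ ε * (n : ℝ) ^ 2 →
        minEquationDegree (nonRigidVariety F n r s) ≤ n ^ 3 := by
  obtain ⟨n₀, hn₀⟩ := h ε hε hε'
  refine ⟨n₀, fun n hn F _ hF r s hr hs => ?_⟩
  obtain ⟨Q, hQ, hdeg⟩ := hn₀ n hn F hF r s hr hs
  rw [nonRigidVariety, minEquationDegree_zariskiClosure]
  exact (minEquationDegree_le hQ).trans hdeg

/-! ### §2.2, Lemma 2.1: images of low-degree maps in few variables have low-degree equations -/

section PolyMaps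

variable {F : Type*} [CommSemiring F] {κ ι : Type*}

/-- The image of the polynomial map `P = (P_i)_{i ∈ ι} : F^κ → F^ι` given by polynomials
`P_i ∈ F[y_κ]` (KV §2.2). [cite: KumarVolk2022, §2.2] -/
def polyMapImage (P : ι → MvPolynomial κ F) : Set (ι → F) :=
  Set.range fun β : κ → F => fun i => eval β (P i)

/-- Membership in the image of a polynomial map. [cite: KumarVolk2022, §2.2] -/
theorem mem_polyMapImage_iff (P : ι → MvPolynomial κ F) (x : ι → F) :
    x ∈ polyMapImage P ↔ ∃ β : κ → F, (fun i => eval β (P i)) = x :=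
  Iff.rfl

end PolyMaps

/-- **Kumar–Volk, Lemma 2.1** ([s2 p0009]): "Let `F` be a field and let `P : F^K → F^N` [be a
polynomial map of degree at most `D`, i.e. every coordinate of `P` is a polynomial of degree at
most `D`, and let `Δ` satisfy `binom(N+Δ, N) > binom(K+DΔ, K)`]. Then there's a non-zero polynomial
`Q ∈ F[y_1, …, y_N]` of degree at most `Δ` such that for any `α` in the image of `P`, `Q(α) = 0`."
(Proof: `Q ↦ Q ∘ P` maps polynomials of degree `≤ Δ` in `N` variables, a space of dimension
`binom(N+Δ, N)`, to polynomials of degree `≤ DΔ` in `K` variables, of dimension `binom(K+DΔ, K)`,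
so it has a kernel.) LOCATOR NOTE: the bracketed hypothesis is a display formula lost in the held
chunk text and is read off the printed proof ("`dim V₁ = binom(N+Δ,N)` … `dim V₂ = binom(K+DΔ,K)`
… by assumption", [s2 p0009]; the arXiv version inlines the same count in the proofs of its
Thms 1, 2, 10, [tex p0005–p0007]); referee to confirm against the journal PDF p. 6:5.
[cite: KumarVolk2022, Lemma 2.1] -/
def kumarVolk2020_lem_2_1 : Prop :=
  ∀ (F : Type) [Field F] (K N D Δ : ℕ) (P : Fin N → MvPolynomial (Fin K) F),
    (∀ i, (P i).totalDegree ≤ D) → Nat.choose (K + D * Δ) K < Nat.choose (N + Δ) N →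
      ∃ Q : MvPolynomial (Fin N) F, IsEquationFor (polyMapImage P) Q ∧ Q.totalDegree ≤ Δ

/-! ### §3: the Shpilka–Volkovich map (Lemma 3.1) and the map for non-rigid matrices (Lemma 3.2) -/

/-- **Kumar–Volk, Lemma 3.1** [SV15] ([s2 p0011]; arXiv Lemma 4): "Let `F` be a field such that
`|F| > n`. Then for all `k ∈ ℕ`, there exists an explicit polynomial map `SV_{n,k}(x, y) : F^{2k} →
Fⁿ` of degree at most `n` such that for any subset `T = {i_1, …, i_k} ⊆ [n]` of size `k`, there
exists a setting `y = α` such that `SV(x, α)` is identically zero on every coordinate `j ∉ T`, and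
equals `x_j` in coordinate `i_j` for all `j ∈ [k]`." (Construction: `P_i(x, y) = ∑_{j} u_i(y_j) x_j`
with `u_i` the Lagrange interpolants at `n` distinct points.) Typed: variables `Fin k ⊕ Fin k`
(`x` = `inl`, `y` = `inr`); a size-`k` subset with its enumeration is an embedding `T : Fin k ↪ Fin n`;
"identically zero / equals `x_j`" is stated for every value of `x` (the coordinates are linear in
`x`, so pointwise and identical vanishing agree); `|F| > n` as an embedding `Fin (n+1) ↪ F`.
[cite: KumarVolk2022, Lemma 3.1] -/
def kumarVolk2020_lem_3_1 : Prop :=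
  ∀ (F : Type) [Field F] (n k : ℕ), Nonempty (Fin (n + 1) ↪ F) →
    ∃ SV : Fin n → MvPolynomial (Fin k ⊕ Fin k) F,
      (∀ i, (SV i).totalDegree ≤ n) ∧
      ∀ T : Fin k ↪ Fin n, ∃ α : Fin k → F, ∀ x : Fin k → F,
        (∀ i : Fin n, i ∉ Set.range T → eval (Sum.elim x α) (SV i) = 0) ∧
        ∀ j : Fin k, eval (Sum.elim x α) (SV (T j)) = x j

/-- **Kumar–Volk, Lemma 3.2** ([s2 p0011]): "For every `r ≤ n` and `s ≤ n²`, there exists an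
explicit polynomial map `P : F^{2rn+2s} → F^{n×n}`, of degree at most `n²`, such that every matrix
`M` that is not `(r,s)` rigid lies in its image." (`P(u,v,x,y) = UV(u,v) + SV_{n²,s}(x,y)`.)
The standing field-size hypothesis of §3 / Thm 1.1 (`|F| ≥ n²`, needed for `SV_{n²,s}`) is made
explicit; variables are indexed by `Fin (2rn+2s)`. [cite: KumarVolk2022, Lemma 3.2] -/
def kumarVolk2020_lem_3_2 : Prop :=
  ∀ (F : Type) [Field F] (n r s : ℕ), Nonempty (Fin (n ^ 2) ↪ F) → r ≤ n → s ≤ n ^ 2 →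
    ∃ P : Fin n × Fin n → MvPolynomial (Fin (2 * r * n + 2 * s)) F,
      (∀ p, (P p).totalDegree ≤ n ^ 2) ∧ nonRigidSet F n r s ⊆ polyMapImage P

end Literature.Computability.AlgebraicComplexity
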